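import Mathlib
import Summits.KontsevichZagierPeriods.KontsevichZagierPeriods.Theorems.SoloBlindStripWalk

/-!
# SoloBlind — lazy confined walks: LEMMA Φ(3) of the hafnian theorem in combinatorial form

Continuation of `SoloBlindStripWalk` (solo-blind programme, `paper/hafnian-theorem.md` §5, s33).
In the proof of THEOREM H the contribution of `t` unsupported primes `u₁, …, u_t` placed in the phase of a
supported prime `p` is `Φ_p(u₁,…,u_t) = 1ᵀ (I + N^{λ_t}) ⋯ (I + N^{λ_1}) 1` over `𝔽₂`, `N^λ` the shift by the
signed index `λ = λ(u)` truncated to the strip `[0,h)`, `h = (p-1)/2` (LEMMA Φ(1): with the half-system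
`{gⁱ : 0 ≤ i < h}` the transfer operator of `u` is `I + N^{λ(u)}`).  Expanding the product, this is the parity
of the number of confined LAZY walks — at each step either stay or jump by `λ_i` — i.e. of
`lazyCount h [λ…] = Σ_{subsequences A} walkCount h A`.  LEMMA Φ(3) ("two or more unsupported primes in one
phase cancel") is the statement that the symmetrisation `Σ_{σ ∈ S_t} Φ_p(u_{σ(1)},…,u_{σ(t)})` vanishes
mod 2 for `t ≥ 2`.  Certified here:

* `lazyCount_reverse` : the lazy count is invariant under reversing the steps (sublists of the reversed
  list are the reversed sublists, and `walkCount_reverse`);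
* `even_sum_perm_of_reverse_invariant` : any reversal-invariant statistic of a list of `r ≥ 2` steps,
  summed over all `r!` orderings, is even (reversal of the ordering is a fixed-point-free involution);
* `even_sum_perm_lazyCount` : hence `Σ_σ lazyCount h (λ ∘ σ)` is even — LEMMA Φ(3).

No multiplicity bookkeeping (`t!/r!`) is needed in this form: the involution acts on the ordering and carries
the jump set along.
-/

namespace Summit.KontsevichZagierPeriods.KontsevichZagierPeriods.Theorems
namespace SoloBlind
namespace StripWalk

open Finset

/-- Number of confined lazy walks with step list `ν`: the sum over all subsequences `A` of `ν` of
`walkCount h A` ( ≡ `1ᵀ ∏ (I + N^{ν_i}) 1` mod 2). -/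
noncomputable def lazyCount (h : ℕ) (ν : List ℤ) : ℕ := (ν.sublists.map (walkCount h)).sum

/-- Reversing the steps does not change the number of confined lazy walks. -/
theorem lazyCount_reverse (h : ℕ) (ν : List ℤ) : lazyCount h ν.reverse = lazyCount h ν := by
  unfold lazyCount
  rw [List.sublists_reverse, List.map_map]
  have h1 : (walkCount h ∘ List.reverse) = walkCount h := by
    funext l
    simp [walkCount_reverse]
  rw [h1]
  exact (List.Perm.sum_eq ((List.sublists_perm_sublists' ν).map _)).symm

/-- A reversal-invariant statistic of `r ≥ 2` integer steps, summed over all orderings of the steps, is even. -/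
theorem even_sum_perm_of_reverse_invariant (F : List ℤ → ℕ) (hF : ∀ l : List ℤ, F l.reverse = F l)
    {r : ℕ} (hr : 2 ≤ r) (ν : Fin r → ℤ) :
    Even (∑ σ : Equiv.Perm (Fin r), F (List.ofFn (ν ∘ ⇑σ))) := by
  classical
  have key : ∀ σ : Equiv.Perm (Fin r),
      F (List.ofFn (ν ∘ ⇑(Fin.revPerm.trans σ))) = F (List.ofFn (ν ∘ ⇑σ)) := by
    intro σ
    have : List.ofFn (ν ∘ ⇑(Fin.revPerm.trans σ)) = (List.ofFn (ν ∘ ⇑σ)).reverse := by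
      rw [← ofFn_comp_rev]
      congr 1
    rw [this, hF]
  have hz : (∑ σ : Equiv.Perm (Fin r), (F (List.ofFn (ν ∘ ⇑σ)) : ZMod 2)) = 0 := by
    refine Finset.sum_involution (fun σ _ => Fin.revPerm.trans σ) ?_ ?_ ?_ ?_
    · intro σ _
      rw [key]
      generalize (F (List.ofFn (ν ∘ ⇑σ)) : ZMod 2) = x
      have h2 : (2 : ZMod 2) = 0 := by decide
      calc x + x = 2 * x := by ring
        _ = 0 := by rw [h2, zero_mul]
    · intro σ _ _ hEq
      have h2 : (Fin.revPerm : Equiv.Perm (Fin r)) = Equiv.refl _ := by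
        have := congrArg (fun e => e.trans σ.symm) hEq
        simpa [Equiv.trans_assoc] using this
      have h3 := congrArg (fun e => ((e ⟨0, by omega⟩ : Fin r) : ℕ)) h2
      simp [Fin.revPerm_apply, Fin.rev] at h3
      omega
    · intro σ _
      exact Finset.mem_univ _
    · intro σ _
      ext x
      simp [Equiv.trans_apply, Fin.revPerm_apply, Fin.rev_rev]
  have hn : ((∑ σ : Equiv.Perm (Fin r), F (List.ofFn (ν ∘ ⇑σ)) : ℕ) : ZMod 2) = 0 := by
    push_cast
    exact hz
  rw [ZMod.natCast_eq_zero_iff] at hn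
  exact even_iff_two_dvd.mpr hn

/-- LEMMA Φ(3) in combinatorial form: for `r ≥ 2` steps the symmetrised lazy count is even. -/
theorem even_sum_perm_lazyCount (h : ℕ) {r : ℕ} (hr : 2 ≤ r) (ν : Fin r → ℤ) :
    Even (∑ σ : Equiv.Perm (Fin r), lazyCount h (List.ofFn (ν ∘ ⇑σ))) :=
  even_sum_perm_of_reverse_invariant (lazyCount h) (lazyCount_reverse h) hr ν

end StripWalk
end SoloBlind
end Summit.KontsevichZagierPeriods.KontsevichZagierPeriods.Theorems
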